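import Summits.BirchSwinnertonDyer.BirchSwinnertonDyer.Theorems.ResidualThetaTransportAtTwoThetaLayerLambdaCongruenceAtTwoLayerAlgebra
import Summits.BirchSwinnertonDyer.BirchSwinnertonDyer.Theorems.ResidualThetaTransportAtTwoResidualThetaMainConjectureAtTwoLayerToolkit
import Mathlib.NumberTheory.Padics.PadicNumbers
import HarnessLib

/-!
# Crux `SmallImageLowerHalfBothSigns` (L, stmt-BirchSwinnertonDyer-23599) — Negative lane:
# the HEADROOM clause of the layer product rule is load-bearing

Refuter ∕ disprover unit `cdisprove-stmt-BirchSwinnertonDyer-23599-g0` (crux item stmt-BirchSwinnertonDyer-23599,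
`SignedLowerHalves.SmallImageLowerHalfBothSigns`; line of record `Cruxes/SmallImageLowerHalfBothSigns/Lines/rtt_w3.lean`, v2).

The analytic transport stub Kan₂ of that line (`stub_thetaLayerLambda_ns`) and its `λ`-reading stub Kλ₂ conclude
`∃ n₀, ∀ n ≥ n₀, λ(depleted ϑ_n(f_W) %ₘ ω_n) = λ(depleted ϑ_n(g) %ₘ ω_n)`; the `n ≥ n₀` clause is there because the only
algebra that turns this into the Greenberg–Vatsal local-term identity is the tree's LAYER PRODUCT RULE
`ThetaLayerLambdaCongruenceAtTwo.layerLambda_mul_modByMonic`: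
for `ω` monic with `‖ω‖_sup ≤ 1`, `‖ω − X^{deg ω}‖_sup < 1`, and `θ, P ≠ 0` with **`λθ + λP < deg ω`** (headroom),
`λ((θ·P) %ₘ ω) = λθ + λP`. This file records, kernel-checked, that the headroom hypothesis CANNOT be dropped — so a
uniform-in-`n` version of Kan₂/Kλ₂ is not available from the layer algebra, and the `∃ n₀` of the stubs is not decoration:

* `layerProductRule_false_without_headroom` — the NEGATION of the product rule with the headroom hypothesis deleted (all
  other hypotheses kept verbatim, universally quantified over ultrametric normed fields); witness over `ℚ₂`: the genuine layer
  modulus `ω = ω₁ = (X+1)² − 1 = X² + 2X` (`p = 2`, `n = 1`), `θ = P = X` (`λ = 1` each, `1 + 1 ≥ deg ω = 2`):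
  `(X·X) %ₘ ω = −2X`, whose `λ` is `1 ≠ 2`. (The sup-norm conclusion of the product rule fails there too:
  `‖−2X‖_sup = 1/2 ≠ 1 = ‖X‖_sup²`, theorem `supNorm_witness`.)

MEANING (a prover's briefing, not a refutation of anything wanted): inside the headroom the rule is a theorem (tree); at
the boundary `λθ + λP = deg ω` it already fails, at the smallest layer of the smallest prime. Kan₂'s `n₀` must therefore be
taken `≥` the first layer with `pⁿ > λ(ϑ_n) + Σ_{v ∈ S₀} λ(P_v)` (the `headroom` column of the disprover's gvkan2 table).
HONEST FRAMING. Thirty lines of normed algebra over `ℚ₂`; nothing about any curve; BSD is proved for no curve here.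
-/

set_option linter.dupNamespace false
set_option autoImplicit false

noncomputable section

open Polynomial
open Literature.NumberTheory.IwasawaTheory
open Summit.BirchSwinnertonDyer.BirchSwinnertonDyer.Theorems

namespace Summit.BirchSwinnertonDyer.BirchSwinnertonDyer.Theorems.SmallImageLowerHalfBothSignsNegative

/-- The layer modulus `ω₁ = (X+1)² − 1 = X² + 2X` at `p = 2` is monic. -/
theorem omega_monic : (X ^ 2 + C (2 : ℚ_[2]) * X).Monic :=
  (monic_X_pow 2).add_of_left
    (lt_of_le_of_lt (degree_C_mul_X_le _) (by rw [degree_X_pow]; exact WithBot.coe_lt_coe.mpr one_lt_two))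

/-- … of degree `2`. -/
theorem omega_natDegree : (X ^ 2 + C (2 : ℚ_[2]) * X).natDegree = 2 := by
  compute_degree!

/-- `‖2X‖_sup = 1/2`. -/
theorem supNorm_C_two_mul_X : (C (2 : ℚ_[2]) * X).supNorm = 2⁻¹ := by
  have h2 : ‖(2 : ℚ_[2])‖ = 2⁻¹ := by simpa using Padic.norm_p (p := 2)  -- `Rank2Observatory.padic_norm_two`
  rw [ResidualThetaLayer.supNorm_C_mul, supNorm_X, mul_one, h2]

/-- `ω₁` is integral: `‖X² + 2X‖_sup ≤ 1`. -/
theorem omega_supNorm_le : (X ^ 2 + C (2 : ℚ_[2]) * X).supNorm ≤ 1 := by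
  refine (ThetaLayerLambdaCongruenceAtTwo.supNorm_add_le_max _ _).trans (max_le ?_ ?_)
  · rw [X_pow_eq_monomial, supNorm_monomial, norm_one]
  · rw [supNorm_C_two_mul_X]; norm_num

/-- `ω₁` is distinguished: `‖ω₁ − X²‖_sup = ‖2X‖_sup = 1/2 < 1`. -/
theorem omega_sub_supNorm_lt :
    (X ^ 2 + C (2 : ℚ_[2]) * X - X ^ (X ^ 2 + C (2 : ℚ_[2]) * X).natDegree).supNorm < 1 := by
  rw [omega_natDegree, add_sub_cancel_left, supNorm_C_two_mul_X]; norm_num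

/-- `(X·X) %ₘ (X² + 2X) = −2X`. -/
theorem X_mul_X_modByMonic : (X * X : ℚ_[2][X]) %ₘ (X ^ 2 + C 2 * X) = C (-2) * X := by
  refine (div_modByMonic_unique 1 (C (-2) * X) omega_monic ⟨?_, ?_⟩).2
  · simp only [C_neg, neg_mul]; ring
  · exact lt_of_le_of_lt (degree_C_mul_X_le _)
      (by rw [degree_eq_natDegree omega_monic.ne_zero, omega_natDegree]; exact WithBot.coe_lt_coe.mpr one_lt_two)

/-- `λ(X) = 1` (the maximal coefficient norm `1` is attained first at index `1`). -/
theorem layerLambda_X : layerLambda (X : ℚ_[2][X]) = 1 := by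
  refine layerLambda_eq_iff.mpr ⟨by rw [supNorm_X, coeff_X_one, norm_one], fun j hj ↦ ?_⟩
  obtain rfl : j = 0 := by omega
  rw [supNorm_X, coeff_X_zero, norm_zero]; exact one_pos

/-- The sup-norm conclusion of the product rule also fails at the witness: `‖(X·X) %ₘ ω₁‖_sup = 1/2 ≠ ‖X‖_sup·‖X‖_sup = 1`. -/
theorem supNorm_witness : ((X * X : ℚ_[2][X]) %ₘ (X ^ 2 + C 2 * X)).supNorm = 2⁻¹ ∧
    (X : ℚ_[2][X]).supNorm * (X : ℚ_[2][X]).supNorm = 1 := by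
  have h2 : ‖(2 : ℚ_[2])‖ = 2⁻¹ := by simpa using Padic.norm_p (p := 2)
  rw [X_mul_X_modByMonic, ResidualThetaLayer.supNorm_C_mul, supNorm_X, norm_neg, h2]; norm_num

/-- **The headroom hypothesis of the layer product rule is load-bearing**: with it deleted the rule is false, witnessed
at the genuine layer modulus `ω₁ = X² + 2X` over `ℚ₂` with `θ = P = X`: `λ((X·X) %ₘ ω₁) = λ(−2X) = 1 ≠ 2 = λX + λX`.
Consequently the `∃ n₀, ∀ n ≥ n₀` clause of Kan₂ ∕ Kλ₂ (line rtt_w3 of crux L) cannot be removed by the layer algebra.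
[topic: BSD ∕ Mazur–Tate layers ∕ Pollack–Weston §3.1 bookkeeping] -/
theorem layerProductRule_false_without_headroom :
    ¬ ∀ (K : Type) [NormedField K] [IsUltrametricDist K] (ω θ P : K[X]), ω.Monic → ω.supNorm ≤ 1 →
        (ω - X ^ ω.natDegree).supNorm < 1 → θ ≠ 0 → P ≠ 0 →
        layerLambda ((θ * P) %ₘ ω) = layerLambda θ + layerLambda P := by
  intro h
  have key := h ℚ_[2] (X ^ 2 + C 2 * X) X X omega_monic omega_supNorm_le omega_sub_supNorm_lt X_ne_zero X_ne_zero
  rw [X_mul_X_modByMonic, ResidualThetaLayer.layerLambda_C_mul (by norm_num), layerLambda_X] at key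
  omega

/-- For contrast: WITH the headroom hypothesis the rule is the tree's theorem (restated at the generality of
`layerProductRule_false_without_headroom`). -/
theorem layerProductRule_with_headroom :
    ∀ (K : Type) [NormedField K] [IsUltrametricDist K] (ω θ P : K[X]), ω.Monic → ω.supNorm ≤ 1 →
      (ω - X ^ ω.natDegree).supNorm < 1 → θ ≠ 0 → P ≠ 0 → layerLambda θ + layerLambda P < ω.natDegree →
      layerLambda ((θ * P) %ₘ ω) = layerLambda θ + layerLambda P :=
  fun _ _ _ _ _ _ hω hω1 hlt hθ hP hlam ↦
    (ThetaLayerLambdaCongruenceAtTwo.layerLambda_mul_modByMonic hω hω1 hlt hθ hP hlam).1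

end Summit.BirchSwinnertonDyer.BirchSwinnertonDyer.Theorems.SmallImageLowerHalfBothSignsNegative

end
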